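import Summits.QuantumFields.YangMills.Theorems.UnitScaleTiltProp8ChartIterSmall
import Summits.QuantumFields.YangMills.Theorems.UnitScaleTiltProp8ChartDiffLocal
import Summits.QuantumFields.YangMills.Theorems.UnitScaleTiltProp8ChartText
import HarnessLib

/-!
# Route `UnitScaleTilt`, crux K1 «MinimiserStabilityRegPr» (stmt-QuantumFields-19200), leaf V2′ `stub_halvingStep` — pillar P3 `ChartPerLevel`:
# **THE hCd CONJUNCT OF `ChartRemainderAt` PROVED: THE MULTI-LEVEL (0.4)-CONSTRAINT MAP IN THE CHART IS ℂ-DIFFERENTIABLE ON THE WEIGHTED SUP-BALL,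
# WITH A k-UNIFORM RADIUS** (`differentiableOn_chartLog_weightedBall`), together with the k-uniform sup bound hCq starts from

Cell `ym3-torus` ∕ fleet seat `ym-ust-19200-p2` g6 (v8 PEN).  Assembly of the factorised engine: p546323 (read sets and their territories:
`weighted_read_bound`), p550515/`…IterSmall` (k-uniform near-flatness of the iterated unguarded average on the read region of an index:
`exists_factorisation_emlIterU`, `norm_emlIterU_sub_one_le_of_reads`), p550249/`…DiffLocal` (local differentiability).
* §1 **`differentiableAt_coe_emlIterU_of_reads`** — for every level `i ≤ m + K`, every set `S` of `i`-sites and every base point `A₀` whose charted bond variables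
  `e^{iηA₀(b)}` are within `s₀` of `1` on the fine bonds under `S`, `6400·ℓ²·Lⁱ·s₀ ≤ 1`: `A ↦ Ū^{(i)}(e^{iηA})(e)` is ℂ-differentiable at `A₀` for every `i`-bond
  `e` with both ends in `S` (induction `S ↦ B⁻¹S`; the loop variables met on the way are within `120ℓ²Lⁱs₀ < 1` of `1`);
* §2 **`differentiableAt_chartLog_apply_of_reads`**, **`norm_chartLog_apply_le_of_reads`** — at an index `(j, c)`: differentiability of `A ↦ chartLog η D A (j,c)` at
  such `A₀` and the bound `‖chartLog η D A₀ (j, c)‖ ≤ 60ℓ·Lʲ·s₀`;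
* §3 **`differentiableOn_chartLog_weightedBall`** — for a member `F`, heights `n, K`, a nested family `D` with `D.k = K − n` and the collar property (e.g.
  `Adm22 D R′ M` with `2L ≤ R′M + 1`, `collar_of_adm22`), the level weights `w` of the F4 pen (`IsLevWeight`), and every radius `R` with
  `12800·ℓ²·L·R ≤ 1`: `DifferentiableOn ℂ (chartLog η D) {Y | ∀ b, w 1 b·‖Y b‖ < R}` — the hCd conjunct of the P3 text with `η = L^{−(K−n)}` and a radius
  depending on `d` and `L` only; **`norm_chartLog_le_weightedBall`**: `‖chartLog η D A (j,c)‖ ≤ 120ℓ·L·R` there (k-uniform; the input of hCq's Cauchy estimate).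
Sorry-free, definition-free.  NOT a claim about the mass gap.

References: T. Bałaban, CMP **102** (1985) 277–309 [Balaban1985Variational] ((44)–(48) p.285, (152)–(157) pp.301–302); CMP **98** (1985) 17–51
[Balaban1985Averaging] (Prop. 4 (134)–(135) p.38); CMP **109** (1987) 249–301 [Balaban1987RG1] ((0.4) p.253, (0.21) p.256).
-/

noncomputable section

open scoped BigOperators
open NormedSpace

namespace Summit.QuantumFields.YangMills.Theorems.Prop8Chart

open Literature.MathematicalPhysics.QuantumFieldTheory.Balaban1983to89
open T4Continuum BlockAveraging AveragingRT ExpMeanLog MatrixLog BlockAveragingEMLLinearised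
open B6SectADomainsV1 (Domains)
open B6SectAOperatorsV1 (BondIdx)
open B5Eq118OneStroke (iterBlockOf iterBlockOf_succ iterBlockOf_zero)
open T3ContinuumYM3Torus (T3Family)
open Summit.QuantumFields.YangMills.Theorems.FlatCubeOpsText (Adm22 IsLevWeight)

variable {P : Params}
variable {𝔸 : Type*} [NormedRing 𝔸] [NormedAlgebra ℂ 𝔸] [CompleteSpace 𝔸] [NormOneClass 𝔸]

/-! ## §1 Differentiability of the iterated average on the read region -/

/-- **`A ↦ Ū^{(i)}(e^{iηA})(e)` IS ℂ-DIFFERENTIABLE AT EVERY BASE POINT WHOSE CHARTED BOND VARIABLES ARE NEAR-FLAT UNDER THE TWO BLOCKS OF `e`** (uniform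
budget `6400ℓ²Lⁱs₀ ≤ 1`; induction over the levels with the k-uniform near-flatness of `…IterSmall`). [cite: Balaban1987RG1, (0.4) p.253, (0.21) p.256] -/
theorem differentiableAt_coe_emlIterU_of_reads (η : ℝ) :
    ∀ (i : ℕ), i ≤ P.m + P.K → ∀ (S : Set (Site P i)) (A₀ : PBond P 0 → 𝔸) (s₀ : ℝ), 0 ≤ s₀ →
      6400 * (((P.d + 2) * P.L : ℕ) : ℝ) ^ 2 * (P.L : ℝ) ^ i * s₀ ≤ 1 →
      (∀ b : PBond P 0, iterBlockOf i b.src ∈ S → iterBlockOf i b.tgt ∈ S → ‖((expCfg η A₀ b : 𝔸ˣ) : 𝔸) - 1‖ ≤ s₀) →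
      ∀ e : PBond P i, e.src ∈ S → e.tgt ∈ S →
        DifferentiableAt ℂ (fun A : PBond P 0 → 𝔸 => ((emlIterU i (expCfg η A) e : 𝔸ˣ) : 𝔸)) A₀ := by
  set ℓ : ℝ := (((P.d + 2) * P.L : ℕ) : ℝ) with hℓ
  have hℓ1 : (1 : ℝ) ≤ ℓ := by
    rw [hℓ]; exact_mod_cast Nat.one_le_iff_ne_zero.mpr (Nat.mul_ne_zero (by omega) (by have := P.hL.2; omega))
  have hℓ0 : (0 : ℝ) ≤ ℓ := by linarith
  have hL1 : (1 : ℝ) ≤ P.L := by exact_mod_cast P.L_pos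
  intro i
  induction i with
  | zero =>
    intro _ S A₀ s₀ _ _ _ e _ _
    simpa only [emlIterU_zero] using differentiableAt_coe_expCfg (P := P) (𝔸 := 𝔸) η e A₀
  | succ i ih =>
    intro hi S A₀ s₀ hs₀ hbudget hA c hcs hct
    have hbudget_i : 6400 * ℓ ^ 2 * (P.L : ℝ) ^ i * s₀ ≤ 1 := by
      refine le_trans ?_ hbudget
      have : (P.L : ℝ) ^ i ≤ (P.L : ℝ) ^ (i + 1) := pow_le_pow_right₀ hL1 (Nat.le_succ i)
      have h0 : 0 ≤ 6400 * ℓ ^ 2 * s₀ := by positivity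
      nlinarith
    set S' : Set (Site P i) := {y | blockOf y ∈ S} with hS'
    have hA' : ∀ b : PBond P 0, iterBlockOf i b.src ∈ S' → iterBlockOf i b.tgt ∈ S' → ‖((expCfg η A₀ b : 𝔸ˣ) : 𝔸) - 1‖ ≤ s₀ :=
      fun b hs ht => hA b (by rw [iterBlockOf_succ]; exact hs) (by rw [iterBlockOf_succ]; exact ht)
    have hF : ∀ e : PBond P i, e.src ∈ S' → e.tgt ∈ S' →
        DifferentiableAt ℂ (fun A : PBond P 0 → 𝔸 => ((emlIterU i (expCfg η A) e : 𝔸ˣ) : 𝔸)) A₀ :=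
      ih (Nat.le_of_succ_le hi) S' A₀ s₀ hs₀ hbudget_i hA'
    -- near-flatness of the level-`i` averages under `S`
    have hnear : ∀ e : PBond P i, e.src ∈ S' → e.tgt ∈ S' →
        ‖((emlIterU i (expCfg η A₀) e : 𝔸ˣ) : 𝔸) - 1‖ ≤ 30 * ℓ * (P.L : ℝ) ^ i * s₀ :=
      fun e hs ht => norm_emlIterU_sub_one_le_of_reads (Nat.le_of_succ_le hi) S' (expCfg η A₀) hs₀ hbudget_i hA' e hs ht
    have hfun : (fun A : PBond P 0 → 𝔸 => ((emlIterU (i + 1) (expCfg η A) c : 𝔸ˣ) : 𝔸)) =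
        fun A => ((emlAvgU (emlIterU i (expCfg η A)) c : 𝔸ˣ) : 𝔸) := by
      funext A; rw [emlIterU_succ]
    rw [hfun]
    have hmem : ∀ b : PBond P i, (blockOf b.src = c.src ∨ blockOf b.src = c.tgt) → (blockOf b.tgt = c.src ∨ blockOf b.tgt = c.tgt) →
        b.src ∈ S' ∧ b.tgt ∈ S' := by
      intro b hbs hbt
      constructor
      · show blockOf b.src ∈ S
        rcases hbs with h | h <;> rw [h]
        exacts [hcs, hct]
      · show blockOf b.tgt ∈ S
        rcases hbt with h | h <;> rw [h]
        exacts [hcs, hct]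
    refine differentiableAt_coe_emlAvgU_of_twoBlock (F := fun A : PBond P 0 → 𝔸 => emlIterU i (expCfg η A)) hi c
      (fun b hbs hbt => hF b (hmem b hbs hbt).1 (hmem b hbs hbt).2) ?_
    have h30 : 0 ≤ 30 * ℓ * (P.L : ℝ) ^ i * s₀ := by positivity
    have hlt : 4 * (((P.d + 2) * P.L : ℕ) : ℝ) * (30 * ℓ * (P.L : ℝ) ^ i * s₀) < 1 := by
      rw [← hℓ]
      have : 4 * ℓ * (30 * ℓ * (P.L : ℝ) ^ i * s₀) = (120 / 6400) * (6400 * ℓ ^ 2 * (P.L : ℝ) ^ i * s₀) := by ring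
      rw [this]; nlinarith
    exact norm_loopHolU_sub_one_lt_one hi c h30 hlt fun b hbs hbt => hnear b (hmem b hbs hbt).1 (hmem b hbs hbt).2

/-! ## §2 At an index bond: differentiability and the sup bound -/

/-- **AT AN INDEX `(j, c)`: `A ↦ chartLog η D A (j, c)` IS ℂ-DIFFERENTIABLE AT EVERY `A₀` WHOSE CHARTED BOND VARIABLES ARE WITHIN `s₀` OF `1` ON THE READ SET,
`6400ℓ²Lʲs₀ ≤ 1`, AND `‖Ū^{(j)}(e^{iηA₀})(c) − 1‖ ≤ 30ℓLʲs₀`.** [cite: Balaban1985Variational, (156) p.302; Balaban1987RG1, (0.21) p.256] -/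
theorem differentiableAt_chartLog_apply_of_reads (η : ℝ) (D : Domains P) (idx : BondIdx D) (A₀ : PBond P 0 → 𝔸) {s₀ : ℝ} (hs₀ : 0 ≤ s₀)
    (hbudget : 6400 * (((P.d + 2) * P.L : ℕ) : ℝ) ^ 2 * (P.L : ℝ) ^ (idx.1.1 : ℕ) * s₀ ≤ 1)
    (hA : ∀ b : PBond P 0, (iterBlockOf (idx.1.1 : ℕ) b.src = idx.1.2.src ∨ iterBlockOf (idx.1.1 : ℕ) b.src = idx.1.2.tgt) →
      (iterBlockOf (idx.1.1 : ℕ) b.tgt = idx.1.2.src ∨ iterBlockOf (idx.1.1 : ℕ) b.tgt = idx.1.2.tgt) → ‖((expCfg η A₀ b : 𝔸ˣ) : 𝔸) - 1‖ ≤ s₀) :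
    DifferentiableAt ℂ (fun A : PBond P 0 → 𝔸 => chartLog η D A idx) A₀ ∧
      ‖((emlIterU (idx.1.1 : ℕ) (expCfg η A₀) idx.1.2 : 𝔸ˣ) : 𝔸) - 1‖ ≤ 30 * (((P.d + 2) * P.L : ℕ) : ℝ) * (P.L : ℝ) ^ (idx.1.1 : ℕ) * s₀ := by
  have hj : (idx.1.1 : ℕ) ≤ P.m + P.K := (Nat.lt_succ_iff.mp idx.1.1.isLt).trans D.hk
  set S : Set (Site P (idx.1.1 : ℕ)) := {y | y = idx.1.2.src ∨ y = idx.1.2.tgt} with hS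
  have hA' : ∀ b : PBond P 0, iterBlockOf (idx.1.1 : ℕ) b.src ∈ S → iterBlockOf (idx.1.1 : ℕ) b.tgt ∈ S →
      ‖((expCfg η A₀ b : 𝔸ˣ) : 𝔸) - 1‖ ≤ s₀ := fun b hs ht => hA b hs ht
  have hnear := norm_emlIterU_sub_one_le_of_reads hj S (expCfg η A₀) hs₀ hbudget hA' idx.1.2 (Or.inl rfl) (Or.inr rfl)
  refine ⟨differentiableAt_chartLog_apply_of η D idx
    (differentiableAt_coe_emlIterU_of_reads η (idx.1.1 : ℕ) hj S A₀ s₀ hs₀ hbudget hA' idx.1.2 (Or.inl rfl) (Or.inr rfl))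
    (hnear.trans_lt ?_), hnear⟩
  have hℓ1 : (1 : ℝ) ≤ (((P.d + 2) * P.L : ℕ) : ℝ) := by
    exact_mod_cast Nat.one_le_iff_ne_zero.mpr (Nat.mul_ne_zero (by omega) (by have := P.hL.2; omega))
  have h1 : 30 * (((P.d + 2) * P.L : ℕ) : ℝ) * (P.L : ℝ) ^ (idx.1.1 : ℕ) * s₀ ≤
      30 * (((P.d + 2) * P.L : ℕ) : ℝ) ^ 2 * (P.L : ℝ) ^ (idx.1.1 : ℕ) * s₀ := by
    have h0 : 0 ≤ (P.L : ℝ) ^ (idx.1.1 : ℕ) * s₀ := by positivity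
    nlinarith [mul_nonneg h0 (by linarith : (0:ℝ) ≤ (((P.d + 2) * P.L : ℕ) : ℝ))]
  linarith

/-- **THE SUP BOUND AT AN INDEX**: under the same hypotheses `‖chartLog η D A₀ (j, c)‖ ≤ 60ℓ·Lʲ·s₀` (`|log X| ≤ 2|X − 1|` for `|X − 1| ≤ ½`).
[cite: Balaban1985Variational, (156) p.302; Balaban1985Averaging, (26) p.22] -/
theorem norm_chartLog_apply_le_of_reads (η : ℝ) (D : Domains P) (idx : BondIdx D) (A₀ : PBond P 0 → 𝔸) {s₀ : ℝ} (hs₀ : 0 ≤ s₀)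
    (hbudget : 6400 * (((P.d + 2) * P.L : ℕ) : ℝ) ^ 2 * (P.L : ℝ) ^ (idx.1.1 : ℕ) * s₀ ≤ 1)
    (hA : ∀ b : PBond P 0, (iterBlockOf (idx.1.1 : ℕ) b.src = idx.1.2.src ∨ iterBlockOf (idx.1.1 : ℕ) b.src = idx.1.2.tgt) →
      (iterBlockOf (idx.1.1 : ℕ) b.tgt = idx.1.2.src ∨ iterBlockOf (idx.1.1 : ℕ) b.tgt = idx.1.2.tgt) → ‖((expCfg η A₀ b : 𝔸ˣ) : 𝔸) - 1‖ ≤ s₀) :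
    ‖chartLog η D A₀ idx‖ ≤ 60 * (((P.d + 2) * P.L : ℕ) : ℝ) * (P.L : ℝ) ^ (idx.1.1 : ℕ) * s₀ := by
  obtain ⟨-, hnear⟩ := differentiableAt_chartLog_apply_of_reads η D idx A₀ hs₀ hbudget hA
  have hℓ1 : (1 : ℝ) ≤ (((P.d + 2) * P.L : ℕ) : ℝ) := by
    exact_mod_cast Nat.one_le_iff_ne_zero.mpr (Nat.mul_ne_zero (by omega) (by have := P.hL.2; omega))
  have hhalf : ‖((emlIterU (idx.1.1 : ℕ) (expCfg η A₀) idx.1.2 : 𝔸ˣ) : 𝔸) - 1‖ ≤ 1 / 2 := by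
    refine hnear.trans ?_
    have h0 : 0 ≤ (P.L : ℝ) ^ (idx.1.1 : ℕ) * s₀ := by positivity
    nlinarith [mul_nonneg h0 (by linarith : (0:ℝ) ≤ (((P.d + 2) * P.L : ℕ) : ℝ))]
  rw [chartLog_apply, norm_smul, norm_neg, Complex.norm_I, one_mul]
  exact (norm_mlog_le_two_mul hhalf).trans (by linarith)

/-! ## §3 The hCd conjunct: differentiability on the weighted ball, k-uniform radius -/

section Weighted

open scoped Matrix.Norms.L2Operator

/-- On the weighted ball the charted bond variables read by a level-`j` index are within `2·L·R·L^{−j}` of `1` (`12800ℓ²LR ≤ 1`).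
[cite: Balaban1985Variational, (152) p.301] -/
theorem norm_expCfg_sub_one_le_of_weightedBall (F : T3Family) (n K : ℕ) (D : Domains (F.P K)) (hDk : D.k = K - n)
    (hcollar : ∀ (i : ℕ) (e : PBond (F.P K) (i + 1)), D.LamBond (i + 1) e → ∀ z : Site (F.P K) i, (blockOf z = e.src ∨ blockOf z = e.tgt) → z ∈ D.Om i)
    {w : ℕ → PBond (F.P K) 0 → ℝ} (hw : IsLevWeight F n K D w) {R : ℝ} (hR : 12800 * ((((F.P K).d + 2) * (F.P K).L : ℕ) : ℝ) ^ 2 * (F.L : ℝ) * R ≤ 1)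
    {A : PBond (F.P K) 0 → Matrix (Fin 2) (Fin 2) ℂ} (hA : ∀ b, w 1 b * ‖A b‖ < R) (idx : BondIdx D) (b : PBond (F.P K) 0)
    (hb : iterBlockOf (idx.1.1 : ℕ) b.src = idx.1.2.src ∨ iterBlockOf (idx.1.1 : ℕ) b.src = idx.1.2.tgt) :
    ‖((expCfg (((F.L : ℝ)⁻¹) ^ (K - n)) A b : (Matrix (Fin 2) (Fin 2) ℂ)ˣ) : Matrix (Fin 2) (Fin 2) ℂ) - 1‖ ≤
      2 * (F.L : ℝ) * R * ((F.L : ℝ) ^ (idx.1.1 : ℕ))⁻¹ := by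
  have hL1 : (1 : ℝ) ≤ F.L := by exact_mod_cast (F.P K).L_pos
  have hL0 : (0 : ℝ) < F.L := by linarith
  have hLj : 0 < (F.L : ℝ) ^ (idx.1.1 : ℕ) := by positivity
  have hℓ1 : (1 : ℝ) ≤ ((((F.P K).d + 2) * (F.P K).L : ℕ) : ℝ) := by
    exact_mod_cast Nat.one_le_iff_ne_zero.mpr (Nat.mul_ne_zero (by omega) (by have := (F.P K).hL.2; omega))
  have hread := weighted_read_bound F n K D hDk hcollar hw hA idx b hb
  -- `η‖A b‖ < L·R·L^{−j}`
  set η : ℝ := ((F.L : ℝ)⁻¹) ^ (K - n) with hη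
  have hη0 : 0 ≤ η := by positivity
  have hηA : η * ‖A b‖ ≤ (F.L : ℝ) * R * ((F.L : ℝ) ^ (idx.1.1 : ℕ))⁻¹ := by
    rw [le_mul_inv_iff₀ hLj]
    calc η * ‖A b‖ * (F.L : ℝ) ^ (idx.1.1 : ℕ) = η * (F.L : ℝ) ^ (idx.1.1 : ℕ) * ‖A b‖ := by ring
      _ ≤ (F.L : ℝ) * R := hread.le
  have hR1 : (F.L : ℝ) * R ≤ 1 := by
    have h0 : 0 ≤ R := by
      have := hA b
      have hw0 : 0 ≤ w 1 b * ‖A b‖ := by rw [hw 1 b, pow_one]; exact mul_nonneg (by positivity) (norm_nonneg _)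
      linarith
    nlinarith [mul_nonneg (by positivity : (0:ℝ) ≤ (F.L : ℝ)) h0]
  have hsmall : ‖((η : ℝ) : ℂ) • A b‖ ≤ 1 := by
    rw [norm_smul, Complex.norm_real, Real.norm_eq_abs, abs_of_nonneg hη0]
    refine hηA.trans ?_
    calc (F.L : ℝ) * R * ((F.L : ℝ) ^ (idx.1.1 : ℕ))⁻¹ ≤ 1 * ((F.L : ℝ) ^ (idx.1.1 : ℕ))⁻¹ := by gcongr
      _ ≤ 1 := by rw [one_mul]; exact inv_le_one_of_one_le₀ (one_le_pow₀ hL1)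
  calc _ ≤ 2 * ‖((η : ℝ) : ℂ) • A b‖ := norm_coe_expCfg_sub_one_le η A b hsmall
    _ = 2 * (η * ‖A b‖) := by rw [norm_smul, Complex.norm_real, Real.norm_eq_abs, abs_of_nonneg hη0]
    _ ≤ 2 * ((F.L : ℝ) * R * ((F.L : ℝ) ^ (idx.1.1 : ℕ))⁻¹) := by gcongr
    _ = 2 * (F.L : ℝ) * R * ((F.L : ℝ) ^ (idx.1.1 : ℕ))⁻¹ := by ring

/-- **THE hCd CONJUNCT OF `ChartRemainderAt`, PROVED**: for a member `F`, heights `n, K`, a nested family `D` with `D.k = K − n` and the collar property, the F4 pen's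
level weights `w`, and every radius with `12800·ℓ²·L·R ≤ 1` (`ℓ = (d+2)L`; k-UNIFORM), the multi-level constraint map `chartLog η D`, `η = L^{−(K−n)}`, is
ℂ-differentiable on the weighted sup-ball `{Y | ∀ b, w 1 b·‖Y b‖ < R}`. [cite: Balaban1985Variational, (44)-(48) p.285, (156)-(157) p.302; Balaban1985Averaging, Prop. 4 p.38] -/
theorem differentiableOn_chartLog_weightedBall (F : T3Family) (n K : ℕ) (D : Domains (F.P K)) (hDk : D.k = K - n)
    (hcollar : ∀ (i : ℕ) (e : PBond (F.P K) (i + 1)), D.LamBond (i + 1) e → ∀ z : Site (F.P K) i, (blockOf z = e.src ∨ blockOf z = e.tgt) → z ∈ D.Om i)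
    {w : ℕ → PBond (F.P K) 0 → ℝ} (hw : IsLevWeight F n K D w) {R : ℝ} (hR : 12800 * ((((F.P K).d + 2) * (F.P K).L : ℕ) : ℝ) ^ 2 * (F.L : ℝ) * R ≤ 1) :
    DifferentiableOn ℂ
      (chartLog (((F.L : ℝ)⁻¹) ^ (K - n)) D :
        (PBond (F.P K) 0 → Matrix (Fin 2) (Fin 2) ℂ) → BondIdx D → Matrix (Fin 2) (Fin 2) ℂ)
      {Y | ∀ b, w 1 b * ‖Y b‖ < R} := by
  have hL1 : (1 : ℝ) ≤ F.L := by exact_mod_cast (F.P K).L_pos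
  have hL0 : (0 : ℝ) < F.L := by linarith
  refine differentiableOn_chartLog_of_forall _ D fun A₀ hA₀ idx => ?_
  have hLj : 0 < (F.L : ℝ) ^ (idx.1.1 : ℕ) := by positivity
  have hR0 : 0 ≤ R := by
    have := hA₀ (⟨fun _ => 0, idx.1.2.dir⟩ : PBond (F.P K) 0)
    have hw0 : 0 ≤ w 1 ⟨fun _ => 0, idx.1.2.dir⟩ * ‖A₀ ⟨fun _ => 0, idx.1.2.dir⟩‖ := by
      rw [hw 1, pow_one]; exact mul_nonneg (by positivity) (norm_nonneg _)
    linarith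
  set s₀ : ℝ := 2 * (F.L : ℝ) * R * ((F.L : ℝ) ^ (idx.1.1 : ℕ))⁻¹ with hs₀
  have hs₀0 : 0 ≤ s₀ := by positivity
  have hbudget : 6400 * ((((F.P K).d + 2) * (F.P K).L : ℕ) : ℝ) ^ 2 * (F.L : ℝ) ^ (idx.1.1 : ℕ) * s₀ ≤ 1 := by
    have : 6400 * ((((F.P K).d + 2) * (F.P K).L : ℕ) : ℝ) ^ 2 * (F.L : ℝ) ^ (idx.1.1 : ℕ) * s₀ =
        12800 * ((((F.P K).d + 2) * (F.P K).L : ℕ) : ℝ) ^ 2 * (F.L : ℝ) * R := by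
      rw [hs₀]; field_simp; ring
    rw [this]; exact hR
  have hA : ∀ b : PBond (F.P K) 0, (iterBlockOf (idx.1.1 : ℕ) b.src = idx.1.2.src ∨ iterBlockOf (idx.1.1 : ℕ) b.src = idx.1.2.tgt) →
      (iterBlockOf (idx.1.1 : ℕ) b.tgt = idx.1.2.src ∨ iterBlockOf (idx.1.1 : ℕ) b.tgt = idx.1.2.tgt) →
      ‖((expCfg (((F.L : ℝ)⁻¹) ^ (K - n)) A₀ b : (Matrix (Fin 2) (Fin 2) ℂ)ˣ) : Matrix (Fin 2) (Fin 2) ℂ) - 1‖ ≤ s₀ :=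
    fun b hb _ => norm_expCfg_sub_one_le_of_weightedBall F n K D hDk hcollar hw hR hA₀ idx b hb
  have hLF : ((F.P K).L : ℝ) = F.L := by norm_cast
  exact (differentiableAt_chartLog_apply_of_reads _ D idx A₀ hs₀0 (by rw [hLF]; exact hbudget) (by exact hA)).1

/-- **THE k-UNIFORM SUP BOUND ON THE WEIGHTED BALL**: `‖chartLog η D A (j, c)‖ ≤ 120ℓ·L·R` at every index, for every `A` in the weighted ball of radius `R`,
`12800·ℓ²·L·R ≤ 1` — the bound the Cauchy estimate of hCq starts from. [cite: Balaban1985Variational, (44)-(47) p.285] -/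
theorem norm_chartLog_le_weightedBall (F : T3Family) (n K : ℕ) (D : Domains (F.P K)) (hDk : D.k = K - n)
    (hcollar : ∀ (i : ℕ) (e : PBond (F.P K) (i + 1)), D.LamBond (i + 1) e → ∀ z : Site (F.P K) i, (blockOf z = e.src ∨ blockOf z = e.tgt) → z ∈ D.Om i)
    {w : ℕ → PBond (F.P K) 0 → ℝ} (hw : IsLevWeight F n K D w) {R : ℝ} (hR : 12800 * ((((F.P K).d + 2) * (F.P K).L : ℕ) : ℝ) ^ 2 * (F.L : ℝ) * R ≤ 1)
    {A : PBond (F.P K) 0 → Matrix (Fin 2) (Fin 2) ℂ} (hA : ∀ b, w 1 b * ‖A b‖ < R) (idx : BondIdx D) :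
    ‖chartLog (((F.L : ℝ)⁻¹) ^ (K - n)) D A idx‖ ≤ 120 * ((((F.P K).d + 2) * (F.P K).L : ℕ) : ℝ) * (F.L : ℝ) * R := by
  have hL1 : (1 : ℝ) ≤ F.L := by exact_mod_cast (F.P K).L_pos
  have hL0 : (0 : ℝ) < F.L := by linarith
  have hLj : 0 < (F.L : ℝ) ^ (idx.1.1 : ℕ) := by positivity
  have hR0 : 0 ≤ R := by
    have := hA (⟨fun _ => 0, idx.1.2.dir⟩ : PBond (F.P K) 0)
    have hw0 : 0 ≤ w 1 ⟨fun _ => 0, idx.1.2.dir⟩ * ‖A ⟨fun _ => 0, idx.1.2.dir⟩‖ := by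
      rw [hw 1, pow_one]; exact mul_nonneg (by positivity) (norm_nonneg _)
    linarith
  set s₀ : ℝ := 2 * (F.L : ℝ) * R * ((F.L : ℝ) ^ (idx.1.1 : ℕ))⁻¹ with hs₀
  have hs₀0 : 0 ≤ s₀ := by positivity
  have hbudget : 6400 * ((((F.P K).d + 2) * (F.P K).L : ℕ) : ℝ) ^ 2 * (F.L : ℝ) ^ (idx.1.1 : ℕ) * s₀ ≤ 1 := by
    have : 6400 * ((((F.P K).d + 2) * (F.P K).L : ℕ) : ℝ) ^ 2 * (F.L : ℝ) ^ (idx.1.1 : ℕ) * s₀ =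
        12800 * ((((F.P K).d + 2) * (F.P K).L : ℕ) : ℝ) ^ 2 * (F.L : ℝ) * R := by
      rw [hs₀]; field_simp; ring
    rw [this]; exact hR
  have hA' : ∀ b : PBond (F.P K) 0, (iterBlockOf (idx.1.1 : ℕ) b.src = idx.1.2.src ∨ iterBlockOf (idx.1.1 : ℕ) b.src = idx.1.2.tgt) →
      (iterBlockOf (idx.1.1 : ℕ) b.tgt = idx.1.2.src ∨ iterBlockOf (idx.1.1 : ℕ) b.tgt = idx.1.2.tgt) →
      ‖((expCfg (((F.L : ℝ)⁻¹) ^ (K - n)) A b : (Matrix (Fin 2) (Fin 2) ℂ)ˣ) : Matrix (Fin 2) (Fin 2) ℂ) - 1‖ ≤ s₀ :=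
    fun b hb _ => norm_expCfg_sub_one_le_of_weightedBall F n K D hDk hcollar hw hR hA idx b hb
  have hLF : ((F.P K).L : ℝ) = F.L := by norm_cast
  have h := norm_chartLog_apply_le_of_reads (((F.L : ℝ)⁻¹) ^ (K - n)) D idx A hs₀0 (by rw [hLF]; exact hbudget) hA'
  rw [hLF] at h
  calc _ ≤ 60 * ((((F.P K).d + 2) * (F.P K).L : ℕ) : ℝ) * (F.L : ℝ) ^ (idx.1.1 : ℕ) * s₀ := h
    _ = 120 * ((((F.P K).d + 2) * (F.P K).L : ℕ) : ℝ) * (F.L : ℝ) * R := by rw [hs₀]; field_simp; ring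

/-- The same two statements with the collar property discharged from (2.2)-admissibility, `2L ≤ R′·M + 1` (`collar_of_adm22`): hCd of the P3 text for EVERY
admissible family, radius `R ≤ 1/(12800ℓ²L)`. [cite: Balaban1985Variational, (44)-(48) p.285; Balaban1984PropagatorsII, (2.2) p.224] -/
theorem differentiableOn_chartLog_weightedBall_of_adm22 (F : T3Family) (n K : ℕ) (D : Domains (F.P K)) (hDk : D.k = K - n) {R' M : ℕ}
    (hAdm : Adm22 D R' M) (hRM : 2 * (F.P K).L ≤ R' * M + 1)
    {w : ℕ → PBond (F.P K) 0 → ℝ} (hw : IsLevWeight F n K D w) {R : ℝ} (hR : 12800 * ((((F.P K).d + 2) * (F.P K).L : ℕ) : ℝ) ^ 2 * (F.L : ℝ) * R ≤ 1) :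
    DifferentiableOn ℂ
      (chartLog (((F.L : ℝ)⁻¹) ^ (K - n)) D :
        (PBond (F.P K) 0 → Matrix (Fin 2) (Fin 2) ℂ) → BondIdx D → Matrix (Fin 2) (Fin 2) ℂ)
      {Y | ∀ b, w 1 b * ‖Y b‖ < R} :=
  differentiableOn_chartLog_weightedBall F n K D hDk (collar_of_adm22 D hAdm hRM) hw hR

end Weighted

end Summit.QuantumFields.YangMills.Theorems.Prop8Chart

end
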